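import Summits.ResolutionOfSingularities.ResolutionOfSingularities.Theorems.MarkedTransferCampaignW46FiniteExitBoundGlue
import Literature.AlgebraicGeometry.Resolution.OrderSemicontinuityPointwise
import Literature.AlgebraicGeometry.Resolution.AlterationsBoundarySmoothLocus
import Literature.AlgebraicGeometry.Resolution.BirationalDimensionInequality
import Literature.AlgebraicGeometry.Resolution.BlowupsIntegral
import Literature.AlgebraicGeometry.Resolution.BlowupsProperProofs
import Literature.AlgebraicGeometry.Resolution.ExceptionalDivisorGenericOrder
import Literature.AlgebraicGeometry.Resolution.BlowupExceptionalGenericOrder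
import Literature.AlgebraicGeometry.Resolution.BlowupExceptionalFibreIrreducible
import Literature.AlgebraicGeometry.Resolution.PermissibleCentres
import HarnessLib

/-!
# [OURS · L1 W4.6 rung (i-a)′] Geometry at the blown-up closed point: dimension, ISOLATION and TAMENESS of the germ
# of `(J, b)` in `regimePlaneIsolated` (cell res-hironaka, LADDER-RESOLUTION rung L, D-0089; campaign s46, seat
# res-D-pv-046 AS res-L1-s46-pv-9 — the SCHEME→RLR DICTIONARY of the centre clause, part 1; host route MarkedTransfer,
# `--supports stmt-ResolutionOfSingularities-16156 --as helper`)

HONEST FRAMING. Nothing here is a statement of H. Hironaka's manuscript (2017-03-23, [Hironaka2017]) and nothing here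
asserts that any statement of it holds. These are TREE-THEOREM assemblies (Görtz–Wedhorn I 5.22 and 13.91/13.96, Stacks
01J7/02OS/0804, Matsumura 15.5 — all PROVED in `Literature/AlgebraicGeometry/Resolution/`) read at a point of the OURS
regime `regimePlaneIsolated` of the campaign. AI review is weaker than expert review. No `sorry`; axioms standard.

## Role in the rung (split of HOME/STATUS 2026-08-27T05:03:39Z / 05:2xZ)

After the run layer (p497699) and the glue (p498215), rung (i-a)′ `PlaneIsolatedFinLocalExitBound` needs only a
ring-isomorphism-invariant germ invariant `ν(R, I, b)` with the CENTRE INEQUALITY under one point blow-up. res-L1-s46-pv-8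
builds `ν` and the inequality in the language of two-dimensional regular local SUBRINGS of a field (quadratic transforms,
`QuadraticTransforms*.lean`); this seat supplies the dictionary from the scheme-level step to that language. This file is
its GERM part — what the regime says about the local ring `𝒪_{Z,ξ}` and the stalk `J_ξ` at the blown-up closed point:

* `ringKrullDim_stalk_eq_of_isClosed_ambient` — at a closed point of an ambient datum `dim 𝒪_{Z,ξ} = dim Z` (GW I 5.22);
  `topologicalKrullDim_eq_of_blowup_closedPoint` — blowing up a closed non-generic point does not change `dim Z` (proper
  birational); hence `ringKrullDim_stalk_eq_of_blowup_closedPoint`: closed points `ξ′` of `Z′` have `dim 𝒪_{Z′,ξ′} = dim 𝒪_{Z,ξ}`.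
* `stalkIdeal_not_le_prime_pow_of_sing_subset_closedPoints` — **ISOLATION**: if `Sing(E)` consists of closed points, then at
  every point `ξ` and for every NON-MAXIMAL prime `𝔮 ⊂ 𝒪_{Z,ξ}`: `J_ξ ⊄ 𝔮^b` (the generization of `ξ` at `𝔮` is a point
  `η ≠ ξ` specializing to `ξ`, hence not closed, hence `ord_η J < b`; but `J_ξ ⊆ 𝔮^b` would give `J_η ⊆ 𝔪_η^b`, Stacks 01J7).
* `stalkIdeal_le_pow_of_mem_sing` — `ξ ∈ Sing(E)` iff `J_ξ ⊆ 𝔪_ξ^b` (unfolding).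
* `not_isClosed_genericPoint_exceptional` / `stalkIdeal_not_le_pow_two_mul_of_step` — **TAMENESS**: for one permissible
  blow-up `π : Z′ → Z` of the closed point `ξ` with `dim 𝒪_{Z,ξ} = 2` and the transform inside `regimePlaneIsolated`:
  the generic point `ζ` of the exceptional curve `π⁻¹(ξ)` has a principal maximal ideal (Stacks 0804), so `dim 𝒪_{Z′,ζ} ≤ 1
  < 2 = dim Z′` and `ζ` is NOT closed; as `Sing(E′)` consists of closed points, `ord_ζ J′ < b`, and
  `ord_ζ J′ = ord_ξ J − b` (tree `IsBlowup.idealOrder_controlledTransform_genericPoint_preimage`) gives `J_ξ ⊄ 𝔪_ξ^{2b}`.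

## References

* U. Görtz, T. Wedhorn, *Algebraic Geometry I* (2nd ed. 2020), Thm. 5.22, Prop. 13.91, Prop. 13.96. [GortzWedhorn2020]
* The Stacks Project, Tags 01J7, 02OS, 0804, 02ND. [StacksProject]
* H. Matsumura, *Commutative Ring Theory* (1986), Thm. 15.5. [Matsumura1987]
-/

noncomputable section

set_option linter.dupNamespace false -- mandated namespace of this single-conjunct summit

open CategoryTheory AlgebraicGeometry TopologicalSpace IsLocalRing

namespace Summit.ResolutionOfSingularities.ResolutionOfSingularities.Theorems

namespace CampaignW46

open Literature.AlgebraicGeometry.Resolution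
open Literature.AlgebraicGeometry.Hironaka2017.S02Preliminaries
open Scheme.IdealSheafData

universe u

variable {p : ℕ} [Fact p.Prime] {K : Type u} [Field K] [CharP K p]

/-! ## Dimension of the local rings at closed points, before and after the blow-up -/

/-- **At a closed point of an ambient datum the local ring has the dimension of the ambient scheme** (`Z` is integral
of finite type over the field `K`; Görtz–Wedhorn I, Thm. 5.22). [cite: GortzWedhorn2020, Thm. 5.22] -/
theorem ringKrullDim_stalk_eq_of_isClosed_ambient (A : AmbientDatum p K) {ξ : A.Z}
    (hξ : IsClosed ({ξ} : Set A.Z)) : ringKrullDim (A.Z.presheaf.stalk ξ) = topologicalKrullDim A.Z := by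
  haveI := ambient_isIntegral A
  haveI := A.smooth
  exact ringKrullDim_stalk_eq_of_isClosed A.hom hξ

/-- A point whose local ring is not a field is not the generic point, so the reduced ideal of `{ξ}` is non-zero and
`{ξ}` has empty interior. [folklore] -/
theorem vanishingIdeal_singleton_ne_bot (A : AmbientDatum p K) {ξ : A.Z} (hξ : IsClosed ({ξ} : Set A.Z))
    (hne : maximalIdeal (A.Z.presheaf.stalk ξ) ≠ ⊥) :
    vanishingIdeal ⟨{ξ}, hξ⟩ ≠ ⊥ ∧ interior ({ξ} : Set A.Z) = ∅ := by
  haveI := ambient_isIntegral A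
  -- `ξ` is not the generic point
  have hgen : ξ ≠ genericPoint A.Z := by
    intro h
    apply hne
    subst h
    exact (IsLocalRing.isField_iff_maximalIdeal_eq).mp (Field.toIsField A.Z.functionField)
  have hopen : ¬ IsOpen ({ξ} : Set A.Z) := by
    intro hop
    have hmem := ((genericPoint_spec A.Z).mem_open_set_iff hop).mpr ⟨ξ, Set.mem_univ _, rfl⟩
    exact hgen (Set.mem_singleton_iff.mp hmem).symm
  refine ⟨fun hbot => ?_, ?_⟩
  · have hsupp := congrArg (fun I : A.Z.IdealSheafData => (I.support : Set A.Z)) hbot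
    simp only [coe_support_vanishingIdeal, Closeds.coe_mk, Scheme.IdealSheafData.support_bot, Closeds.coe_top] at hsupp
    apply hopen
    rw [hsupp]
    exact isOpen_univ
  · rw [interior_eq_empty_iff_dense_compl]
    rw [dense_iff_closure_eq, ← Set.univ_subset_iff]
    intro z _
    by_contra hz
    have hzopen : IsOpen ((closure ({ξ}ᶜ : Set A.Z))ᶜ) := isClosed_closure.isOpen_compl
    have hsub : (closure ({ξ}ᶜ : Set A.Z))ᶜ ⊆ {ξ} := by
      intro w hw
      by_contra hw'
      exact hw (subset_closure hw')
    have hξmem : ξ ∈ (closure ({ξ}ᶜ : Set A.Z))ᶜ := by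
      have := hsub hz
      rw [Set.mem_singleton_iff] at this
      rwa [this] at hz
    apply hopen
    have heq : ((closure ({ξ}ᶜ : Set A.Z))ᶜ) = {ξ} :=
      Set.Subset.antisymm hsub (Set.singleton_subset_iff.mpr hξmem)
    rw [← heq]
    exact hzopen

/-- **Blowing up a closed point does not change the dimension of the ambient scheme** (`π` is proper and birational,
Matsumura 15.5 / Stacks 0ECG as assembled in `BirationalDimensionInequality.lean`). [cite: Matsumura1987, Thm. 15.5] -/
theorem topologicalKrullDim_eq_of_blowup_closedPoint (A A' : AmbientDatum p K) {ξ : A.Z}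
    (hξ : IsClosed ({ξ} : Set A.Z)) (hne : maximalIdeal (A.Z.presheaf.stalk ξ) ≠ ⊥) {π : A'.Z ⟶ A.Z}
    (hπ : IsBlowup π (vanishingIdeal ⟨{ξ}, hξ⟩)) : topologicalKrullDim A'.Z = topologicalKrullDim A.Z := by
  haveI := ambient_isIntegral A
  haveI := ambient_isIntegral A'
  haveI : IsLocallyNoetherian A.Z := ambient_isLocallyNoetherian A
  haveI : IsProper π := hπ.isProper
  exact (hπ.isBirational' (vanishingIdeal_singleton_ne_bot A hξ hne).1).topologicalKrullDim_eq_of_isProper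

/-- **Closed points of the blown-up ambient scheme have local rings of the same dimension as `𝒪_{Z,ξ}`** (`ξ` the closed
centre). [cite: GortzWedhorn2020, Thm. 5.22] -/
theorem ringKrullDim_stalk_eq_of_blowup_closedPoint (A A' : AmbientDatum p K) {ξ : A.Z}
    (hξ : IsClosed ({ξ} : Set A.Z)) (hne : maximalIdeal (A.Z.presheaf.stalk ξ) ≠ ⊥) {π : A'.Z ⟶ A.Z}
    (hπ : IsBlowup π (vanishingIdeal ⟨{ξ}, hξ⟩)) {ξ' : A'.Z} (hξ' : IsClosed ({ξ'} : Set A'.Z)) :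
    ringKrullDim (A'.Z.presheaf.stalk ξ') = ringKrullDim (A.Z.presheaf.stalk ξ) := by
  rw [ringKrullDim_stalk_eq_of_isClosed_ambient A' hξ', ringKrullDim_stalk_eq_of_isClosed_ambient A hξ,
    topologicalKrullDim_eq_of_blowup_closedPoint A A' hξ hne hπ]

/-! ## Isolation: the germ of `(J, b)` at a point of a state with `Sing(E) ⊆` closed points -/

/-- **ISOLATION of the germ.** On any scheme, if `Sing(E) = {ord ≥ b}` consists of closed points, then for every point
`ξ` and every non-maximal prime `𝔮` of `𝒪_{Z,ξ}`: `J_ξ ⊄ 𝔮^b`. Indeed `𝔮` is the prime of a generization `η ⤳ ξ`,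
`η ≠ ξ` (Stacks 01J7), `𝒪_{Z,η} = (𝒪_{Z,ξ})_𝔮` and `J_η = J_ξ 𝒪_{Z,η}`; so `J_ξ ⊆ 𝔮^b` gives `J_η ⊆ 𝔪_η^b`, i.e.
`η ∈ Sing(E)`, and `η` would be a closed point specializing to `ξ ≠ η`. [cite: StacksProject, Tag 01J7] -/
theorem stalkIdeal_not_le_prime_pow_of_sing_subset_closedPoints {Z : Scheme.{u}} (E : IdealExponent Z)
    (hcl : E.sing ⊆ Literature.AlgebraicGeometry.Hironaka2017.S02Preliminaries.closedPoints Z) (ξ : Z) (𝔮 : Ideal (Z.presheaf.stalk ξ)) [𝔮.IsPrime]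
    (h𝔮 : 𝔮 ≠ maximalIdeal (Z.presheaf.stalk ξ)) : ¬ stalkIdeal E.J ξ ≤ 𝔮 ^ E.b := by
  intro hle
  obtain ⟨η, hηξ, h𝔮eq⟩ := exists_specializes_comap_stalkSpecializes_eq ξ 𝔮
  letI := (Z.presheaf.stalkSpecializes hηξ).hom.toAlgebra
  haveI hloc := isLocalizationAtPrime_stalkSpecializes (X := Z) hηξ
  -- `J_η = J_ξ 𝒪_η ⊆ 𝔮^b 𝒪_η = 𝔪_η^b`
  have hJη : stalkIdeal E.J η ≤ maximalIdeal (Z.presheaf.stalk η) ^ E.b := by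
    rw [← stalkIdeal_map_stalkSpecializes E.J hηξ]
    have h1 : (stalkIdeal E.J ξ).map (Z.presheaf.stalkSpecializes hηξ).hom ≤
        (𝔮 ^ E.b).map (Z.presheaf.stalkSpecializes hηξ).hom := Ideal.map_mono hle
    refine h1.trans ?_
    rw [Ideal.map_pow]
    refine Ideal.pow_right_mono ?_ E.b
    have hmap : 𝔮.map (algebraMap (Z.presheaf.stalk ξ) (Z.presheaf.stalk η)) =
        maximalIdeal (Z.presheaf.stalk η) := by
      rw [h𝔮eq]
      exact IsLocalization.AtPrime.map_eq_maximalIdeal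
        ((maximalIdeal (Z.presheaf.stalk η)).comap (Z.presheaf.stalkSpecializes hηξ).hom) (Z.presheaf.stalk η)
    rw [RingHom.algebraMap_toAlgebra] at hmap
    exact hmap.le
  -- so `η ∈ Sing(E)`, a closed point
  have hηS : η ∈ E.sing := (le_idealOrder_iff E.J η E.b).mpr hJη
  have hηcl : IsClosed ({η} : Set Z) := hcl hηS
  -- `ξ ∈ closure {η} = {η}`
  have hξη : ξ = η := by
    have : ξ ∈ closure ({η} : Set Z) := hηξ.mem_closure
    rw [hηcl.closure_eq, Set.mem_singleton_iff] at this
    exact this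
  subst hξη
  apply h𝔮
  rw [h𝔮eq]
  have hid : Z.presheaf.stalkSpecializes hηξ = 𝟙 _ := TopCat.Presheaf.stalkSpecializes_refl _ _
  rw [hid]
  exact Ideal.comap_id _

/-- Unfolding: `ξ ∈ Sing(E)` iff `J_ξ ⊆ 𝔪_ξ^b`. [folklore] -/
theorem mem_sing_iff_stalkIdeal_le_pow {Z : Scheme.{u}} (E : IdealExponent Z) (ξ : Z) :
    ξ ∈ E.sing ↔ stalkIdeal E.J ξ ≤ maximalIdeal (Z.presheaf.stalk ξ) ^ E.b :=
  le_idealOrder_iff E.J ξ E.b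

/-! ## Tameness: `ord_ξ J < 2b` when the transform lies in the regime -/

/-- A generic point of a closed set is one of its maximal points. [folklore] -/
theorem mem_maxPoints_of_isGenericPoint {Z : Scheme.{u}} {S : Set Z} {ζ : Z} (hζ : IsGenericPoint ζ S) :
    ζ ∈ maxPoints S := by
  refine ⟨hζ.mem, fun η hη hsp => ?_⟩
  exact (hsp.antisymm (hζ.specializes hη)).eq

/-- **The generic point of the exceptional curve is not a closed point.** For the blowing up `π : Z′ → Z` of a closed
point `ξ` of an ambient datum with `dim 𝒪_{Z,ξ} = 2`: `π⁻¹(ξ)` is irreducible (tree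
`IsBlowup.isIrreducible_preimage_singleton`), the maximal ideal at its generic point `ζ` is principal (Stacks 0804, tree
`IsBlowup.exists_uniformizer_of_mem_maxPoints`), so `dim 𝒪_{Z′,ζ} ≤ 1` by Krull's principal ideal theorem, while closed
points of `Z′` have local rings of dimension `dim Z′ = dim Z = 2`. [cite: StacksProject, Tag 0804] -/
theorem not_isClosed_genericPoint_exceptional (A A' : AmbientDatum p K) {ξ : A.Z} (hξ : IsClosed ({ξ} : Set A.Z))
    (hdim : ringKrullDim (A.Z.presheaf.stalk ξ) = 2) {π : A'.Z ⟶ A.Z}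
    (hπ : IsBlowup π (vanishingIdeal ⟨{ξ}, hξ⟩)) {ζ : A'.Z} (hζ : IsGenericPoint ζ (π ⁻¹' {ξ})) :
    ¬ IsClosed ({ζ} : Set A'.Z) := by
  haveI := ambient_isIntegral A
  haveI := ambient_isIntegral A'
  haveI : IsLocallyNoetherian A.Z := ambient_isLocallyNoetherian A
  haveI : IsLocallyNoetherian A'.Z := ambient_isLocallyNoetherian A'
  haveI : IsRegularLocalRing (A.Z.presheaf.stalk ξ) := ambient_isRegular A ξ
  have hne : maximalIdeal (A.Z.presheaf.stalk ξ) ≠ ⊥ := by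
    intro hbot
    have hf : IsField (A.Z.presheaf.stalk ξ) := (IsLocalRing.isField_iff_maximalIdeal_eq).mpr hbot
    have h0 := ringKrullDim_eq_zero_of_isField hf
    rw [hdim] at h0
    exact absurd h0 (by decide)
  intro hζcl
  -- `π ζ = ξ`
  have hπζ : π ζ = ξ := hζ.mem
  -- the maximal ideal of `𝒪_{Z′,ζ}` is principal
  subst hπζ
  have hmax : ζ ∈ maxPoints (π ⁻¹' ((⟨{π ζ}, hξ⟩ : Closeds A.Z) : Set A.Z)) := mem_maxPoints_of_isGenericPoint hζ
  have hy : stalkIdeal (vanishingIdeal ⟨{π ζ}, hξ⟩) (π ζ) = maximalIdeal (A.Z.presheaf.stalk (π ζ)) :=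
    stalkIdeal_vanishingIdeal_singleton (X := A.Z) hξ
  obtain ⟨t, -, hmt, -⟩ := hπ.exists_uniformizer_of_mem_maxPoints hmax hy
  -- hence `dim 𝒪_{Z′,ζ} ≤ 1`
  have hdimζ : ringKrullDim (A'.Z.presheaf.stalk ζ) ≤ 1 := by
    haveI : (Ideal.span {t} : Ideal (A'.Z.presheaf.stalk ζ)).IsPrincipal := ⟨⟨t, rfl⟩⟩
    have hmin : maximalIdeal (A'.Z.presheaf.stalk ζ) ∈ (Ideal.span {t} : Ideal (A'.Z.presheaf.stalk ζ)).minimalPrimes := by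
      rw [← hmt, Ideal.minimalPrimes_eq_subsingleton_self]
      exact Set.mem_singleton _
    have h1 := Ideal.height_le_one_of_isPrincipal_of_mem_minimalPrimes (Ideal.span {t}) _ hmin
    rw [← IsLocalRing.maximalIdeal_height_eq_ringKrullDim]
    exact_mod_cast h1
  -- but closed points of `Z′` have dimension `2`
  have h2 : ringKrullDim (A'.Z.presheaf.stalk ζ) = 2 := by
    rw [ringKrullDim_stalk_eq_of_blowup_closedPoint A A' hξ hne hπ hζcl, hdim]
  rw [h2] at hdimζ
  exact absurd hdimζ (by decide)

/-- **TAMENESS of the germ.** For one permissible blow-up `π : Z′ → Z` of the closed point `ξ` (the centre `{ξ}` §2.1-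
permissible for `E`, e.g. a step of a `FinPermissibleRun`), with `dim 𝒪_{Z,ξ} = 2` and the transform `E′` having all its
singular points closed (e.g. `(Z′, E′)` in `regimePlaneIsolated`): `J_ξ ⊄ 𝔪_ξ^{2b}`. For at the generic point `ζ` of the
exceptional curve `ord_ζ J′ = ord_ξ J − b` (tree `IsBlowup.idealOrder_controlledTransform_genericPoint_preimage`), and `ζ`
is not closed, so `ord_ζ J′ < b`. [cite: StacksProject, Tag 0804] -/
theorem stalkIdeal_not_le_pow_two_mul_of_step (A A' : AmbientDatum p K) (E : IdealExponent A.Z) {ξ : A.Z}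
    (hξ : IsClosed ({ξ} : Set A.Z)) (hdim : ringKrullDim (A.Z.presheaf.stalk ξ) = 2)
    (hD : E.IsPermissibleCentre A.hom ⟨{ξ}, hξ⟩) {π : A'.Z ⟶ A.Z} (hπ : IsBlowup π (vanishingIdeal ⟨{ξ}, hξ⟩))
    (hcl' : (E.transform π ⟨{ξ}, hξ⟩).sing ⊆ Literature.AlgebraicGeometry.Hironaka2017.S02Preliminaries.closedPoints A'.Z) :
    ¬ stalkIdeal E.J ξ ≤ maximalIdeal (A.Z.presheaf.stalk ξ) ^ (2 * E.b) := by
  haveI := ambient_isIntegral A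
  haveI := ambient_isIntegral A'
  haveI : IsLocallyNoetherian A.Z := ambient_isLocallyNoetherian A
  haveI : IsLocallyNoetherian A'.Z := ambient_isLocallyNoetherian A'
  haveI : IsRegularLocalRing (A.Z.presheaf.stalk ξ) := ambient_isRegular A ξ
  have hne : maximalIdeal (A.Z.presheaf.stalk ξ) ≠ ⊥ := by
    intro hbot
    have hf : IsField (A.Z.presheaf.stalk ξ) := (IsLocalRing.isField_iff_maximalIdeal_eq).mpr hbot
    have h0 := ringKrullDim_eq_zero_of_isField hf
    rw [hdim] at h0
    exact absurd h0 (by decide)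
  intro hle
  -- the exceptional curve and its generic point
  have hm : stalkIdeal (vanishingIdeal ⟨{ξ}, hξ⟩) ξ = maximalIdeal (A.Z.presheaf.stalk ξ) :=
    stalkIdeal_vanishingIdeal_singleton (X := A.Z) hξ
  have hirr : IsIrreducible (π ⁻¹' ({ξ} : Set A.Z)) := hπ.isIrreducible_preimage_singleton ξ hm hne
  have hclosed : IsClosed (π ⁻¹' ({ξ} : Set A.Z)) := hξ.preimage π.continuous
  set ζ := hirr.genericPoint with hζdef
  have hζ : IsGenericPoint ζ (π ⁻¹' ({ξ} : Set A.Z)) := hirr.isGenericPoint_genericPoint hclosed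
  have hπζ : π ζ = ξ := hζ.mem
  -- `ord_ζ J′ = ord_ξ J − b`
  have hX : Scheme.IsRegular A.Z := ambient_isRegular A
  have hDreg : Scheme.IsRegular (vanishingIdeal (⟨{ξ}, hξ⟩ : Closeds A.Z)).subscheme := by
    haveI := hD.smooth
    exact fun z => isRegularLocalRing_stalk_of_smooth_of_field ((vanishingIdeal (⟨{ξ}, hξ⟩ : Closeds A.Z)).subschemeι ≫ A.hom) z
  have hint : interior (((⟨{ξ}, hξ⟩ : Closeds A.Z)) : Set A.Z) = ∅ := (vanishingIdeal_singleton_ne_bot A hξ hne).2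
  have hord := hπ.idealOrder_controlledTransform_genericPoint_preimage hX hDreg
    (by exact isIrreducible_singleton) hint hζ E.J E.b
  -- `ord_ξ J ≥ 2b` gives `ord_ζ J′ ≥ b`
  have hge : ((2 * E.b : ℕ) : ℕ∞) ≤ idealOrder E.J ξ := (le_idealOrder_iff E.J ξ (2 * E.b)).mpr hle
  have hζsing : ζ ∈ (E.transform π ⟨{ξ}, hξ⟩).sing := by
    show ((E.b : ℕ) : ℕ∞) ≤ idealOrder (controlledTransform π (vanishingIdeal ⟨{ξ}, hξ⟩) E.J E.b) ζ
    rw [hord, hπζ]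
    -- `2b ≤ o` gives `b ≤ o - b` in `ℕ∞`
    have key : ∀ o : ℕ∞, ((2 * E.b : ℕ) : ℕ∞) ≤ o → ((E.b : ℕ) : ℕ∞) ≤ o - ((E.b : ℕ) : ℕ∞) := by
      intro o ho
      induction o using ENat.recTopCoe with
      | top => rw [ENat.top_sub_coe]; exact le_top
      | coe n =>
        have hn : 2 * E.b ≤ n := by exact_mod_cast ho
        rw [← ENat.coe_sub]
        exact_mod_cast (show E.b ≤ n - E.b by omega)
    exact key _ hge
  exact not_isClosed_genericPoint_exceptional A A' hξ hdim hπ hζ (hcl' hζsing)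

/-- **Tameness read in the campaign's step format** (binders of the glue's centre clause): both states in
`regimePlaneIsolated`, `dim 𝒪_{Z,ξ} = 2`. [folklore] -/
theorem stalkIdeal_not_le_pow_two_mul_of_regime {A A' : AmbientDatum p K} {E : IdealExponent A.Z}
    {E' : IdealExponent A'.Z} {ξ : A.Z} {hξ : IsClosed ({ξ} : Set A.Z)} {π : A'.Z ⟶ A.Z}
    (hRg' : regimePlaneIsolated A' E') (hD : E.IsPermissibleCentre A.hom ⟨{ξ}, hξ⟩)
    (hπ : IsBlowup π (vanishingIdeal ⟨{ξ}, hξ⟩)) (hEE' : E' = E.transform π ⟨{ξ}, hξ⟩)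
    (hdim : ringKrullDim (A.Z.presheaf.stalk ξ) = 2) :
    ¬ stalkIdeal E.J ξ ≤ maximalIdeal (A.Z.presheaf.stalk ξ) ^ (2 * E.b) := by
  subst hEE'
  exact stalkIdeal_not_le_pow_two_mul_of_step A A' E hξ hdim hD hπ hRg'.2.2

/-- **Isolation read in the campaign's format**: in `regimePlaneIsolated`, at every point and every non-maximal prime `𝔮`
of the local ring, `J_ξ ⊄ 𝔮^b`. [folklore] -/
theorem stalkIdeal_not_le_prime_pow_of_regime {A : AmbientDatum p K} {E : IdealExponent A.Z}
    (hRg : regimePlaneIsolated A E) (ξ : A.Z) (𝔮 : Ideal (A.Z.presheaf.stalk ξ)) [𝔮.IsPrime]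
    (h𝔮 : 𝔮 ≠ maximalIdeal (A.Z.presheaf.stalk ξ)) : ¬ stalkIdeal E.J ξ ≤ 𝔮 ^ E.b :=
  stalkIdeal_not_le_prime_pow_of_sing_subset_closedPoints E hRg.2.2 ξ 𝔮 h𝔮

end CampaignW46

end Summit.ResolutionOfSingularities.ResolutionOfSingularities.Theorems

end
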